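import Mathlib.Algebra.QuaternionBasis
import Mathlib.Algebra.QuadraticAlgebra.Basic
import Mathlib.LinearAlgebra.FiniteDimensional.Lemmas
import Mathlib.RingTheory.SimpleRing.Congr
import Literature.NumberTheory.QuadraticForms.HilbertSymbolQuaternion
import Literature.NumberTheory.Automorphic.QuaternionAlgebraEmbedding
import HarnessLib

/-!
# Quaternion algebras `{L, θ}`, quadratic subfields, and the reduction of the local–global
# isomorphism principle to Hasse's norm theorem

Companion file of `Literature.NumberTheory.Automorphic.QuaternionAlgebraAdelic` (namespace
`Literature.Automorphic`), second level of the decomposition of the named fact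
`nonempty_algEquiv_of_ramifiedPlaces_eq K D` (Vignéras, LNM 800, Ch. III §3 Thm. 3.1, uniqueness:
*quaternion algebras over a number field with the same ramification are isomorphic*).

Vignéras's uniqueness argument (III §3, proofs of Cor. 3.4, Thm. 3.7, Thm. 3.8) runs: two
quaternion algebras `H`, `H'` have a common quadratic subfield `L` (Thm. 3.8), so `H = {L,θ}`,
`H' = {L,θ'}` (I §2 Cor. 2.2); if `H_v ≃ H'_v` everywhere then `θ'/θ ∈ n(L_v)` everywhere, hence
`θ'/θ ∈ n(L)` by the norm theorem in quadratic extensions (Cor. 3.4), and `{L,θ n(m)} ≅ {L,θ}`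
(I §1). This file makes that reduction honest in Lean, in the concrete model
`{K(√a), θ} = ℍ[K,a,θ]` (Mathlib's `QuaternionAlgebra K a 0 θ`: `i² = a`, `j² = θ`, `j m = m̄ j`
for `m ∈ L = K + K i`), with `n(x + y√a) = x² - a y²` modelled by Mathlib's
`QuadraticAlgebra.norm` on `QuadraticAlgebra K a 0 = K[X]/(X² - a)`.

What is **proved**:

* `IsNormFromSqrt a θ` (`θ ∈ n(K(√a))`) and its calculus (multiplicative, inverses, `a` square
  `⇒` everything is a norm, anisotropy for `a` non-square); `ℍ[F,a,0]` is not simple;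
* **rescaling** `ℍ[F,a,b n(m)] ≃ₐ[F] ℍ[F,a,b]` (I §1: *on peut remplacer `θ` par `θ m m̄`*);
* **I §2 Cor. 2.2** `IsQuaternionAlgebra.exists_algEquiv_quaternionAlgebra_of_sq_eq`: a quaternion
  algebra containing `x` with `x² = a` non-square is `≃ₐ[K] ℍ[K,a,θ]` *with the same `a`* and some
  `θ ≠ 0` (elementary proof replacing Skolem–Noether: `u = x d - d x` anticommutes with `x`,
  `1, x, u, xu` is a basis, `u²` is central) — compare the sibling `QuaternionAlgebraStructure`,
  whose `exists_algEquiv_quaternionAlgebra` produces *some* `ℍ[K,a,b]`;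
* the **local step** `QuaternionAlgebra.isNormFromSqrt_div_of_algEquiv`:
  `ℍ[F,a,θ] ≃ₐ[F] ℍ[F,a,θ'] ⇒ θ'/θ ∈ n(F(√a))` over any field with `2 ≠ 0` (Skolem–Noether for the
  subfield `L` done by an explicit conjugator in the division case; in the non-division case both
  `θ` and `θ'` are norms by I §2 Cor. 2.4, imported from the sibling `QuaternionAlgebraSplitting`
  as `QuaternionAlgebra.exists_sq_sub_mul_sq_of_not_isUnit`);
* the **assembly** `nonempty_algEquiv_of_completions_of_norm_facts`: the local–global principle
  for isomorphism of quaternion algebras over a number field (exactness of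
  `1 → Quat(K) → ⊕_v Quat(K_v)` in Thm. 3.1) follows from the two named facts below, using the
  base change `K_v ⊗_K ℍ[K,a,b] ≃ ℍ[K_v,a,b]` of `QuaternionAlgebraSplitting`
  (`ScalarExtension.nonempty_algEquiv_quaternionAlgebra`, Vignéras I §1 p. 3).

What is **vendored as named facts** (cited, to be discharged in later sessions):

* `Literature.hilbertSymbol_eq_one_of_forall_completions K a θ` — Vignéras III §3 Cor. 3.4 (Hasse's norm
  theorem for `K(√a)/K`, as the local–global principle `(a, θ)_v = 1 ∀ v ⇒ (a, θ)_K = 1` for the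
  Hilbert symbol of `Literature/NumberTheory/QuadraticForms/HilbertSymbol.lean`; namespace `Literature`
  and `K`-parameterised like `hilbertReciprocity`, `exists_hilbertSymbol_eq_neg_one_iff`);
* `exists_common_quadratic_subfield K D` — Vignéras III §3 Thm. 3.8 (2) (two quaternion algebras
  over a number field have a common quadratic subfield); not an independent input: it is
  discharged here relative to Thm. 3.8 (1) and `ramifiedPlaces_finite`
  (`exists_common_quadratic_subfield_of_facts`, from `exists_common_sq_eq_of_facts` of the sibling
  `QuaternionAlgebraEmbedding`).

Mathlib (pinned) has `QuaternionAlgebra.Basis`/`liftHom`, `QuadraticAlgebra.norm`,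
`IsSimpleRing`, but no Skolem–Noether theorem, no Hasse norm theorem and no classification of
quaternion algebras over local or global fields (`rg` for `Skolem|HasseNorm|normTheorem`). From
the Literature tree: the norm form, units, Cor. 2.4 and base change of `ℍ[K,a,b]` come from the
sibling `QuaternionAlgebraSplitting`; the Hilbert symbol `hilbertSymbol F a b` (`= 1` iff
`a x² + b y² = 1` is soluble), its bridge to `x² - a y² = b`
(`exists_sq_sub_mul_sq_iff_hilbertSymbol_eq_one`) and the two other class-field-theoretic inputs
of Vignéras III §3 already vendored there — `hilbertReciprocity` (Cor. 3.3) and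
`exists_hilbertSymbol_eq_neg_one_iff` (Thm. 3.7 / O'Meara 71:19) — come from
`Literature/NumberTheory/QuadraticForms/` (`HilbertSymbol`, `HilbertSymbolQuaternion`,
`HilbertSymbolPrescribed`); the new input Cor. 3.4 is stated in the same vocabulary.

## References

* M.-F. Vignéras, *Arithmétique des algèbres de quaternions*, LNM 800 (1980): Ch. I §1 pp. 1–3
  (`{L,θ}`, produits tensoriels), §2 Thm. 2.1, Cor. 2.2, Cor. 2.4; Ch. III §3 Thm. 3.1, Cor. 3.4,
  Thm. 3.8.
-/

noncomputable section

open scoped TensorProduct Quaternion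
open NumberField IsDedekindDomain

universe u v

namespace Literature.NumberTheory.Automorphic

/-! ### Norms from `F(√a)` -/

section NormForm

variable {F : Type*} [Field F]

/-- `IsNormFromSqrt a θ`: `θ ∈ n(F(√a))`, i.e. `θ` is a norm from the quadratic algebra
`F(√a) = F[X]/(X² - a)`, modelled by Mathlib's `QuadraticAlgebra F a 0` (`ω² = a`) and its norm
`QuadraticAlgebra.norm ⟨x, y⟩ = x² - a y²` (Vignéras I §1: `n(m) = m m̄`). [folklore] -/
def IsNormFromSqrt (a θ : F) : Prop :=
  θ ∈ Set.range (QuadraticAlgebra.norm (R := F) (a := a) (b := 0))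

/-- `θ ∈ n(F(√a))` iff `θ = x² - a y²` for some `x y : F`. [folklore] -/
theorem isNormFromSqrt_iff {a θ : F} : IsNormFromSqrt a θ ↔ ∃ x y : F, θ = x ^ 2 - a * y ^ 2 := by
  constructor
  · rintro ⟨z, rfl⟩
    exact ⟨z.re, z.im, by rw [QuadraticAlgebra.norm_def]; ring⟩
  · rintro ⟨x, y, rfl⟩
    exact ⟨⟨x, y⟩, by rw [QuadraticAlgebra.norm_def]; ring⟩

/-- **Bridge to the Hilbert symbol** of `Literature/NumberTheory/QuadraticForms/HilbertSymbol.lean`: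
for `a θ ≠ 0` and `2 ≠ 0`, `θ ∈ n(F(√a))` iff `(a, θ)_F = 1`
(`exists_sq_sub_mul_sq_iff_hilbertSymbol_eq_one` of `HilbertSymbolQuaternion`, O'Meara §63B).
[folklore] -/
theorem isNormFromSqrt_iff_hilbertSymbol_eq_one [NeZero (2 : F)] {a θ : F} (ha : a ≠ 0)
    (hθ : θ ≠ 0) : IsNormFromSqrt a θ ↔ QuadraticForms.hilbertSymbol F a θ = 1 := by
  rw [isNormFromSqrt_iff, ← QuadraticForms.exists_sq_sub_mul_sq_iff_hilbertSymbol_eq_one ha hθ]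
  simp only [eq_comm]

/-- Norms are multiplicative. [folklore] -/
theorem IsNormFromSqrt.mul {a θ θ' : F} (h : IsNormFromSqrt a θ) (h' : IsNormFromSqrt a θ') :
    IsNormFromSqrt a (θ * θ') := by
  obtain ⟨z, rfl⟩ := h
  obtain ⟨z', rfl⟩ := h'
  exact ⟨z * z', map_mul _ _ _⟩

/-- The inverse of a non-zero norm is a norm (`(x² - a y²)⁻¹ = n((x - y√a)/(x² - a y²))`). [folklore] -/
theorem IsNormFromSqrt.inv {a θ : F} (h : IsNormFromSqrt a θ) : IsNormFromSqrt a θ⁻¹ := by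
  rcases eq_or_ne θ 0 with rfl | hθ
  · rwa [inv_zero]
  obtain ⟨x, y, rfl⟩ := isNormFromSqrt_iff.mp h
  refine isNormFromSqrt_iff.mpr ⟨x / (x ^ 2 - a * y ^ 2), y / (x ^ 2 - a * y ^ 2), ?_⟩
  field_simp

/-- Quotients of non-zero norms are norms. [folklore] -/
theorem IsNormFromSqrt.div {a θ θ' : F} (h : IsNormFromSqrt a θ) (h' : IsNormFromSqrt a θ') :
    IsNormFromSqrt a (θ / θ') := by
  rw [div_eq_mul_inv]; exact h.mul h'.inv

/-- If `a = c²` is a non-zero square (and `2 ≠ 0`), every `θ` is a norm from `F(√a) ≅ F × F`: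
`θ = x² - c² y²` with `x - c y = 1`, `x + c y = θ` (for `θ ≠ 0` this is
`hilbertSymbol_eq_one_of_isSquare` of `HilbertSymbol.lean` through the bridge). [folklore] -/
theorem IsNormFromSqrt.of_isSquare [NeZero (2 : F)] {a : F} (ha : IsSquare a) (ha0 : a ≠ 0)
    (θ : F) : IsNormFromSqrt a θ := by
  obtain ⟨c, rfl⟩ := ha
  have hc : c ≠ 0 := fun h ↦ ha0 (by rw [h, mul_zero])
  have h2 : (2 : F) ≠ 0 := two_ne_zero
  refine isNormFromSqrt_iff.mpr ⟨(1 + θ) / 2, (θ - 1) / (2 * c), ?_⟩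
  field_simp
  ring

/-- If `a` is not a square, the norm form is anisotropic: `x² - a y² = 0 → x = 0 ∧ y = 0`. [folklore] -/
theorem eq_zero_of_sq_sub_mul_sq_eq_zero {a : F} (ha : ¬ IsSquare a) {x y : F}
    (h : x ^ 2 - a * y ^ 2 = 0) : x = 0 ∧ y = 0 := by
  by_cases hy : y = 0
  · subst hy
    simpa using h
  · exfalso
    exact ha ⟨x / y, by field_simp; linear_combination -h⟩

end NormForm

/-! ### The algebras `ℍ[F,a,b] = {F(√a), b}`: non-simplicity of `ℍ[F,a,0]`, rescaling -/

section Toolkit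

variable {F : Type*} [Field F]

/-- **Rescaling `u ↦ m u`** (Vignéras I §1: *on peut remplacer `θ` par `θ m m̄`*): for
`N = p² - a q² = n(p + q i) ≠ 0`, the elements `i` and `j' = (p + q i) j = p j + q k` of `ℍ[F,a,b]`
form a quaternionic basis of type `(a, b N)`, and the induced map `ℍ[F,a,b N] → ℍ[F,a,b]` is an
isomorphism. [cite: VignerasLNM800, Ch. I §1] -/
def QuaternionAlgebra.rescaleBasis (a b p q : F) :
    QuaternionAlgebra.Basis ℍ[F,a,b] a 0 (b * (p ^ 2 - a * q ^ 2)) where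
  i := ⟨0, 1, 0, 0⟩
  j := ⟨0, 0, p, q⟩
  k := ⟨0, 0, q * a, p⟩
  i_mul_i := by ext <;> simp
  j_mul_j := by ext <;> simp <;> ring
  i_mul_j := by ext <;> simp; ring
  j_mul_i := by ext <;> simp; ring

/-- The rescaling map `ℍ[F,a,b N] →ₐ[F] ℍ[F,a,b]` in coordinates. [folklore] -/
theorem QuaternionAlgebra.rescaleBasis_liftHom_apply (a b p q : F) (x : ℍ[F,a,b * (p ^ 2 - a * q ^ 2)]) :
    (QuaternionAlgebra.rescaleBasis a b p q).liftHom x =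
      ⟨x.re, x.imI, p * x.imJ + q * a * x.imK, q * x.imJ + p * x.imK⟩ := by
  ext <;> simp [QuaternionAlgebra.rescaleBasis, QuaternionAlgebra.Basis.liftHom_apply,
    QuaternionAlgebra.Basis.lift, QuaternionAlgebra.algebraMap_eq] <;> ring

/-- **`{L, θ n(m)} ≅ {L, θ}`** (Vignéras I §1 p. 2): for `N = p² - a q² ≠ 0`,
`ℍ[F,a,b N] ≃ₐ[F] ℍ[F,a,b]`. Honest proof: the rescaling map is injective (a `2 × 2` system of
determinant `N`), hence bijective by dimension `4 = 4`. [cite: VignerasLNM800, Ch. I §1] -/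
theorem QuaternionAlgebra.nonempty_algEquiv_rescale {a b θ' : F} (p q : F)
    (hN : p ^ 2 - a * q ^ 2 ≠ 0) (hθ' : θ' = b * (p ^ 2 - a * q ^ 2)) :
    Nonempty (ℍ[F,a,θ'] ≃ₐ[F] ℍ[F,a,b]) := by
  subst hθ'
  set f := (QuaternionAlgebra.rescaleBasis a b p q).liftHom with hf
  have hinj : Function.Injective f := by
    rw [injective_iff_map_eq_zero]
    intro x hx
    rw [hf, QuaternionAlgebra.rescaleBasis_liftHom_apply] at hx
    obtain ⟨h1, h2, h3, h4⟩ := (QuaternionAlgebra.ext_iff).mp hx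
    simp only [QuaternionAlgebra.re_zero, QuaternionAlgebra.imI_zero, QuaternionAlgebra.imJ_zero,
      QuaternionAlgebra.imK_zero] at h1 h2 h3 h4
    have hJ : (p ^ 2 - a * q ^ 2) * x.imJ = 0 := by linear_combination p * h3 - q * a * h4
    have hK : (p ^ 2 - a * q ^ 2) * x.imK = 0 := by linear_combination p * h4 - q * h3
    rcases mul_eq_zero.mp hJ with h | hJ
    · exact absurd h hN
    rcases mul_eq_zero.mp hK with h | hK
    · exact absurd h hN
    exact QuaternionAlgebra.ext h1 h2 hJ hK
  have hsurj : Function.Surjective f :=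
    (LinearMap.injective_iff_surjective_of_finrank_eq_finrank (f := f.toLinearMap)
      (by rw [QuaternionAlgebra.finrank_eq_four, QuaternionAlgebra.finrank_eq_four])).mp hinj
  exact ⟨AlgEquiv.ofBijective f ⟨hinj, hsurj⟩⟩

/-- `ℍ[F,a,0]` (`j² = 0`) is not simple: `F j + F k` is a non-trivial two-sided ideal. Used to
see that the constant `θ` produced by Cor. 2.2 is invertible. [folklore] -/
theorem QuaternionAlgebra.not_isSimpleRing_of_c₃_eq_zero (a : F) : ¬ IsSimpleRing ℍ[F,a,(0 : F)] := by
  intro hS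
  let I : TwoSidedIdeal ℍ[F,a,(0 : F)] := TwoSidedIdeal.mk' {q | q.re = 0 ∧ q.imI = 0}
    ⟨rfl, rfl⟩
    (fun {x y} hx hy ↦ ⟨by simp [hx.1, hy.1], by simp [hx.2, hy.2]⟩)
    (fun {x} hx ↦ ⟨by simp [hx.1], by simp [hx.2]⟩)
    (fun {x y} hy ↦ ⟨by simp [hy.1, hy.2], by simp [hy.1, hy.2]⟩)
    (fun {x y} hx ↦ ⟨by simp [hx.1, hx.2], by simp [hx.1, hx.2]⟩)
  have hmem : ∀ q : ℍ[F,a,(0 : F)], q ∈ I ↔ q.re = 0 ∧ q.imI = 0 :=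
    fun q ↦ TwoSidedIdeal.mem_mk' _ _ _ _ _ _ q
  rcases IsSimpleOrder.eq_bot_or_eq_top I with h | h
  · have hj : (⟨0, 0, 1, 0⟩ : ℍ[F,a,(0 : F)]) ∈ I := (hmem _).mpr ⟨rfl, rfl⟩
    rw [h, TwoSidedIdeal.mem_bot] at hj
    exact one_ne_zero (congrArg QuaternionAlgebra.imJ hj)
  · have h1 : (1 : ℍ[F,a,(0 : F)]) ∈ I := by rw [h]; exact TwoSidedIdeal.mem_top _
    exact one_ne_zero ((hmem _).mp h1).1

end Toolkit

/-! ### Functoriality of base change in `D` -/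

section Functoriality

variable {K : Type*} [Field K] {F : Type*} [CommRing F] [Algebra K F]

/-- Base change is functorial in `D`: `D ≃ₐ[K] D'` induces `F ⊗_K D ≃ₐ[F] F ⊗_K D'`
(Mathlib `Algebra.TensorProduct.congr`). [folklore] -/
def ScalarExtension.congrRight {D : Type*} [Ring D] [Algebra K D] {D' : Type*} [Ring D']
    [Algebra K D'] (e : D ≃ₐ[K] D') : ScalarExtension K F D ≃ₐ[F] ScalarExtension K F D' :=
  (Algebra.TensorProduct.congr (AlgEquiv.refl : F ≃ₐ[F] F) e : F ⊗[K] D ≃ₐ[F] F ⊗[K] D')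

/-- `congrRight e (1 ⊗ d) = 1 ⊗ e d`. [folklore] -/
@[simp]
theorem ScalarExtension.congrRight_incl {D : Type*} [Ring D] [Algebra K D] {D' : Type*} [Ring D']
    [Algebra K D'] (e : D ≃ₐ[K] D') (d : D) :
    ScalarExtension.congrRight (F := F) e (ScalarExtension.incl K F D d) =
      ScalarExtension.incl K F D' (e d) :=
  Algebra.TensorProduct.map_tmul _ _ _ _

end Functoriality

/-! ### Quadratic subfields: `H ⊇ L` quadratic `⇒ H = {L, θ}` (Vignéras I §2 Cor. 2.2) -/

section QuadraticSubfield

variable (K : Type*) [Field K] {D : Type u} [Ring D] [Algebra K D]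

/-- In an algebra over a field, `α + β x` is a unit as soon as `(α, β) ≠ 0`, `x² = a` and `a` is
not a square: `(α + β x)(α - β x) = α² - a β² ≠ 0`. [folklore] -/
theorem isUnit_algebraMap_add_smul_of_sq_eq {a : K} (ha : ¬ IsSquare a) {x : D}
    (hx : x * x = algebraMap K D a) (α β : K) (hne : α ≠ 0 ∨ β ≠ 0) :
    IsUnit (algebraMap K D α + β • x) := by
  have hN : α ^ 2 - a * β ^ 2 ≠ 0 := fun h0 ↦ by
    obtain ⟨h1, h2⟩ := eq_zero_of_sq_sub_mul_sq_eq_zero ha h0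
    rcases hne with h | h <;> contradiction
  have hx1 : x * x = a • (1 : D) := by rw [hx, Algebra.algebraMap_eq_smul_one]
  set N := α ^ 2 - a * β ^ 2 with hNdef
  have hmm' : (algebraMap K D α + β • x) * (algebraMap K D α - β • x) = N • (1 : D) := by
    simp only [Algebra.algebraMap_eq_smul_one, add_mul, mul_sub, smul_mul_assoc, mul_smul_comm,
      one_mul, mul_one, hx1, smul_smul, hNdef]
    module
  have hm'm : (algebraMap K D α - β • x) * (algebraMap K D α + β • x) = N • (1 : D) := by
    simp only [Algebra.algebraMap_eq_smul_one, sub_mul, mul_add, smul_mul_assoc, mul_smul_comm,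
      one_mul, mul_one, hx1, smul_smul, hNdef]
    module
  refine ⟨⟨_, N⁻¹ • (algebraMap K D α - β • x), ?_, ?_⟩, rfl⟩
  · rw [mul_smul_comm, hmm', smul_smul, inv_mul_cancel₀ hN, one_smul]
  · rw [smul_mul_assoc, hm'm, smul_smul, inv_mul_cancel₀ hN, one_smul]

/-- **Vignéras I §2 Cor. 2.2** (*Pour toute algèbre séparable quadratique `L/K` contenue dans `H`,
il existe `θ ∈ Kˣ` tel que `H = {L, θ}`*), in the model `{K(√a), θ} = ℍ[K,a,θ]`: if a quaternion
algebra `D` over a field `K` with `2 ≠ 0` contains `x` with `x² = a`, `a` not a square in `K`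
(i.e. the quadratic field `L = K(√a) ↪ D`), then `D ≃ₐ[K] ℍ[K,a,θ]` for some `θ ≠ 0`.
Honest elementary proof (in place of Skolem–Noether): for `d` not commuting with `x`,
`u = x d - d x ≠ 0` anticommutes with `x`; `1, x, u, x u` are linearly independent (a relation
gives `(2 a g₃ + 2 g₂ x) u = 0`, and `α + β x` is a unit), hence a basis; `u²` commutes with the
basis, so `u² = θ ∈ K`; and `θ ≠ 0` because `ℍ[K,a,0]` is not simple. [cite: VignerasLNM800, Ch. I §2 Cor. 2.2] -/
theorem IsQuaternionAlgebra.exists_algEquiv_quaternionAlgebra_of_sq_eq [NeZero (2 : K)]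
    [IsQuaternionAlgebra K D] {a : K} (ha : ¬ IsSquare a) {x : D}
    (hx : x * x = algebraMap K D a) :
    ∃ θ : K, θ ≠ 0 ∧ Nonempty (D ≃ₐ[K] ℍ[K,a,θ]) := by
  classical
  haveI := IsQuaternionAlgebra.isSimpleRing' K D
  have ha0 : a ≠ 0 := fun h ↦ ha ⟨0, by rw [h, mul_zero]⟩
  have h20 : (2 : K) ≠ 0 := two_ne_zero
  have hx1 : x * x = a • (1 : D) := by rw [hx, Algebra.algebraMap_eq_smul_one]
  -- `x` is not a scalar
  have hxK : ∀ r : K, x ≠ algebraMap K D r := by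
    rintro r rfl
    rw [← map_mul] at hx
    exact ha ⟨r, (FaithfulSMul.algebraMap_injective K D hx).symm⟩
  -- some `d` does not commute with `x`
  obtain ⟨d, hd⟩ : ∃ d : D, x * d ≠ d * x := by
    by_contra! h
    have hmem : x ∈ Subalgebra.center K D := Subalgebra.mem_center_iff.mpr fun y ↦ (h y).symm
    rw [Algebra.IsCentral.center_eq_bot, Algebra.mem_bot] at hmem
    obtain ⟨r, hr⟩ := hmem
    exact hxK r hr.symm
  set u := x * d - d * x with hu_def
  have hu0 : u ≠ 0 := sub_ne_zero.mpr hd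
  have hux : u * x = -(x * u) := by
    have e1 : x * u = a • d - x * d * x := by
      rw [hu_def, mul_sub, ← mul_assoc, hx1, smul_mul_assoc, one_mul, mul_assoc]
    have e2 : u * x = x * d * x - a • d := by
      rw [hu_def, sub_mul, mul_assoc d x x, hx1, mul_smul_comm, mul_one]
    rw [e1, e2, neg_sub]
  have hxux : x * u * x = -(a • u) := by
    rw [mul_assoc, hux, mul_neg, ← mul_assoc, hx1, smul_mul_assoc, one_mul]
  -- linear independence of `1, x, u, x u`
  have hli : LinearIndependent K ![(1 : D), x, u, x * u] := by
    rw [Fintype.linearIndependent_iff]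
    intro g hg
    simp only [Fin.sum_univ_four, Matrix.cons_val_zero, Matrix.cons_val_one, Matrix.cons_val,
      ] at hg
    -- `x S - S x = 2 g₂ (x u) + 2 a g₃ u = (2 a g₃ + 2 g₂ x) u`
    have hcomm : (algebraMap K D (2 * a * g 3) + (2 * g 2) • x) * u = 0 := by
      have hxS : x * (g 0 • (1 : D) + g 1 • x + g 2 • u + g 3 • (x * u)) -
          (g 0 • (1 : D) + g 1 • x + g 2 • u + g 3 • (x * u)) * x = 0 := by
        rw [hg, mul_zero, zero_mul, sub_zero]
      rw [Algebra.algebraMap_eq_smul_one, add_mul, smul_mul_assoc, smul_mul_assoc, one_mul]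
      rw [← hxS]
      simp only [mul_add, add_mul, mul_smul_comm, smul_mul_assoc, mul_one, one_mul, hx1,
        ← mul_assoc x x u, hux, hxux, smul_neg, mul_smul_comm, smul_smul]
      module
    have h23 : g 2 = 0 ∧ g 3 = 0 := by
      by_contra hne
      have hne' : 2 * a * g 3 ≠ 0 ∨ 2 * g 2 ≠ 0 := by
        by_cases h3 : g 3 = 0
        · have h2 : g 2 ≠ 0 := fun h2 ↦ hne ⟨h2, h3⟩
          exact Or.inr (mul_ne_zero h20 h2)
        · exact Or.inl (mul_ne_zero (mul_ne_zero h20 ha0) h3)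
      obtain ⟨w, hw⟩ := isUnit_algebraMap_add_smul_of_sq_eq K ha hx _ _ hne'
      apply hu0
      have := congrArg (fun z ↦ (↑w⁻¹ : D) * z) hcomm
      simpa only [← hw, ← mul_assoc, Units.inv_mul, one_mul, mul_zero] using this
    obtain ⟨h2, h3⟩ := h23
    rw [h2, h3, zero_smul, zero_smul, add_zero, add_zero] at hg
    have h1 : g 1 = 0 := by
      by_contra h1
      apply hxK (-(g 0 / g 1))
      rw [Algebra.algebraMap_eq_smul_one]
      have hx' : g 1 • x = -(g 0 • (1 : D)) := eq_neg_of_add_eq_zero_right hg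
      calc x = (g 1)⁻¹ • (g 1 • x) := by rw [smul_smul, inv_mul_cancel₀ h1, one_smul]
        _ = (-(g 0 / g 1)) • (1 : D) := by rw [hx']; module
    rw [h1, zero_smul, add_zero] at hg
    have h0 : g 0 = 0 := by
      rwa [smul_eq_zero, or_iff_left (one_ne_zero' D)] at hg
    intro i
    fin_cases i <;> assumption
  have hcard : Fintype.card (Fin 4) = Module.finrank K D := by
    rw [Fintype.card_fin, IsQuaternionAlgebra.finrank_eq_four]
  have hspan : Submodule.span K (Set.range ![(1 : D), x, u, x * u]) = ⊤ :=
    hli.span_eq_top_of_card_eq_finrank hcard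
  -- `θ := u²` is central
  set t := u * u with ht_def
  have hxu : x * u = -(u * x) := by rw [hux, neg_neg]
  have htx : x * t = t * x := by
    rw [ht_def, ← mul_assoc, hxu, neg_mul, mul_assoc, hxu, mul_neg, neg_neg, mul_assoc]
  have htu : u * t = t * u := by rw [ht_def, mul_assoc]
  have htcen : ∀ y : D, y * t = t * y := by
    intro y
    have hy : y ∈ Submodule.span K (Set.range ![(1 : D), x, u, x * u]) := by rw [hspan]; trivial
    refine Submodule.span_induction ?_ ?_ ?_ ?_ hy
    · rintro _ ⟨i, rfl⟩
      fin_cases i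
      · simp
      · exact htx
      · exact htu
      · show x * u * t = t * (x * u)
        rw [mul_assoc, htu, ← mul_assoc, htx, mul_assoc]
    · simp
    · intro y z _ _ hy hz
      rw [add_mul, mul_add, hy, hz]
    · intro c y _ hy
      rw [smul_mul_assoc, mul_smul_comm, hy]
  have htmem : t ∈ Subalgebra.center K D := Subalgebra.mem_center_iff.mpr fun y ↦ htcen y
  rw [Algebra.IsCentral.center_eq_bot, Algebra.mem_bot] at htmem
  obtain ⟨θ, hθ⟩ := htmem
  -- the quaternionic basis `x, u, x u` of type `(a, θ)`
  let q : QuaternionAlgebra.Basis D a 0 θ :=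
    { i := x
      j := u
      k := x * u
      i_mul_i := by rw [hx1, zero_smul, add_zero]
      j_mul_j := by rw [← ht_def, ← hθ, Algebra.algebraMap_eq_smul_one]
      i_mul_j := rfl
      j_mul_i := by rw [hux, zero_smul, zero_sub] }
  have hinj : Function.Injective q.liftHom := by
    rw [injective_iff_map_eq_zero]
    intro z hz
    have hz' : z.re • (1 : D) + z.imI • x + z.imJ • u + z.imK • (x * u) = 0 := by
      simpa only [QuaternionAlgebra.Basis.liftHom_apply, QuaternionAlgebra.Basis.lift,
        Algebra.algebraMap_eq_smul_one] using hz
    have := Fintype.linearIndependent_iff.mp hli ![z.re, z.imI, z.imJ, z.imK]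
      (by simpa [Fin.sum_univ_four] using hz')
    ext
    · exact this 0
    · exact this 1
    · exact this 2
    · exact this 3
  have hsurj : Function.Surjective q.liftHom :=
    (LinearMap.injective_iff_surjective_of_finrank_eq_finrank (f := q.liftHom.toLinearMap)
      (by rw [QuaternionAlgebra.finrank_eq_four, IsQuaternionAlgebra.finrank_eq_four])).mp hinj
  let e : D ≃ₐ[K] ℍ[K,a,θ] := (AlgEquiv.ofBijective q.liftHom ⟨hinj, hsurj⟩).symm
  refine ⟨θ, ?_, ⟨e⟩⟩
  rintro rfl
  exact QuaternionAlgebra.not_isSimpleRing_of_c₃_eq_zero a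
    (IsSimpleRing.of_ringEquiv e.toRingEquiv inferInstance)

end QuadraticSubfield

/-! ### Isomorphic `{L, θ} ≅ {L, θ'}` forces `θ'/θ ∈ n(L)` -/

section LocalStep

variable {F : Type*} [Field F]

/-- In `ℍ[F,a,θ']` (`a ≠ 0`, `2 ≠ 0`) an element anticommuting with `i` lies in `F j + F k = L u`.
[folklore] -/
theorem QuaternionAlgebra.re_imI_eq_zero_of_anticommute [NeZero (2 : F)] {a θ' : F} (ha : a ≠ 0)
    {w : ℍ[F,a,θ']} (hw : w * ⟨0, 1, 0, 0⟩ = -(⟨0, 1, 0, 0⟩ * w)) : w.re = 0 ∧ w.imI = 0 := by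
  have lhs : w * ⟨0, 1, 0, 0⟩ = (⟨a * w.imI, w.re, -(a * w.imK), -w.imJ⟩ : ℍ[F,a,θ']) := by
    ext <;> simp
  have rhs : (⟨0, 1, 0, 0⟩ : ℍ[F,a,θ']) * w = ⟨a * w.imI, w.re, a * w.imK, w.imJ⟩ := by
    ext <;> simp
  rw [lhs, rhs, QuaternionAlgebra.neg_mk] at hw
  simp only [QuaternionAlgebra.mk.injEq] at hw
  obtain ⟨h1, h2, -, -⟩ := hw
  have h2' : (2 : F) * w.re = 0 := by linear_combination h2
  have h1' : (2 * a) * w.imI = 0 := by linear_combination h1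
  refine ⟨?_, ?_⟩
  · rcases mul_eq_zero.mp h2' with h | h
    · exact absurd h two_ne_zero
    · exact h
  · rcases mul_eq_zero.mp h1' with h | h
    · exact absurd h (mul_ne_zero two_ne_zero ha)
    · exact h

/-- **`{L,θ} ≅ {L,θ'} ⇒ θ'/θ ∈ n(L)`** over any field `F` with `2 ≠ 0` (`L = F(√a)`, `a ≠ 0`):
if `ℍ[F,a,θ] ≃ₐ[F] ℍ[F,a,θ']` with `θ θ' ≠ 0` then `θ'/θ` is a norm from `F(√a)`. This is the
step of Vignéras's uniqueness proof (III §3, proof of Thm. 3.8: *l'algèbre `{L,θ}` est isomorphe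
à `H`*) that combines I §2 Thm. 2.1 (Skolem–Noether) and Cor. 2.4. Honest proof: if `a` is a
square every element is a norm; if `ℍ[F,a,θ']` is not a division ring, `θ'` and `θ` are norms by
Cor. 2.4 (`QuaternionAlgebra.exists_sq_sub_mul_sq_of_not_isUnit` of `QuaternionAlgebraSplitting`);
if it is a division ring, conjugate the image of `i`
back to `i` by an explicit unit `c` (`i c = c y` for `c = i + y` or `c = j`), so that the image
`z'` of `j` anticommutes with `i`, i.e. `z' = m j` with `m ∈ L`, and `θ = z'² = n(m) θ'`.
[cite: VignerasLNM800, Ch. I §2 Thm. 2.1, Cor. 2.4] -/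
theorem QuaternionAlgebra.isNormFromSqrt_div_of_algEquiv [NeZero (2 : F)] {a θ θ' : F}
    (ha : a ≠ 0) (hθ : θ ≠ 0) (hθ' : θ' ≠ 0) (e : ℍ[F,a,θ] ≃ₐ[F] ℍ[F,a,θ']) :
    IsNormFromSqrt a (θ' / θ) := by
  by_cases hsq : IsSquare a
  · exact IsNormFromSqrt.of_isSquare hsq ha _
  by_cases hdiv : ∀ h : ℍ[F,a,θ'], h ≠ 0 → IsUnit h
  · -- division case
    set i' : ℍ[F,a,θ'] := ⟨0, 1, 0, 0⟩ with hi'_def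
    set y : ℍ[F,a,θ'] := e ⟨0, 1, 0, 0⟩ with hy_def
    set z : ℍ[F,a,θ'] := e ⟨0, 0, 1, 0⟩ with hz_def
    have hi' : i' * i' = a • (1 : ℍ[F,a,θ']) := by ext <;> simp [hi'_def]
    have hy : y * y = a • (1 : ℍ[F,a,θ']) := by
      rw [hy_def, ← map_mul, show (⟨0, 1, 0, 0⟩ : ℍ[F,a,θ]) * ⟨0, 1, 0, 0⟩ = a • 1 by ext <;> simp,
        map_smul, map_one]
    have hz : z * z = θ • (1 : ℍ[F,a,θ']) := by
      rw [hz_def, ← map_mul, show (⟨0, 0, 1, 0⟩ : ℍ[F,a,θ]) * ⟨0, 0, 1, 0⟩ = θ • 1 by ext <;> simp,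
        map_smul, map_one]
    have hzy : z * y = -(y * z) := by
      rw [hz_def, hy_def, ← map_mul, ← map_mul, ← map_neg,
        show (⟨0, 0, 1, 0⟩ : ℍ[F,a,θ]) * ⟨0, 1, 0, 0⟩ = -(⟨0, 1, 0, 0⟩ * ⟨0, 0, 1, 0⟩) by
          ext <;> simp]
    -- a unit `c` with `i' c = c y`
    obtain ⟨c, hc⟩ : ∃ c : (ℍ[F,a,θ'])ˣ, i' * c = c * y := by
      by_cases hyi : i' + y = 0
      · have hy' : y = -i' := eq_neg_of_add_eq_zero_right hyi
        have hj : IsUnit (⟨0, 0, 1, 0⟩ : ℍ[F,a,θ']) :=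
          hdiv _ (fun h ↦ one_ne_zero (congrArg QuaternionAlgebra.imJ h))
        obtain ⟨c, hc⟩ := hj
        refine ⟨c, ?_⟩
        rw [hc, hy', mul_neg]
        ext <;> simp [hi'_def]
      · obtain ⟨c, hc⟩ := hdiv _ hyi
        refine ⟨c, ?_⟩
        rw [hc, mul_add, add_mul, hy, hi']
        abel
    have hcinv : (↑c⁻¹ : ℍ[F,a,θ']) * i' = y * ↑c⁻¹ := by
      calc (↑c⁻¹ : ℍ[F,a,θ']) * i' = ↑c⁻¹ * (i' * ↑c) * ↑c⁻¹ := by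
            rw [mul_assoc, mul_assoc, Units.mul_inv, mul_one]
        _ = y * ↑c⁻¹ := by rw [hc, ← mul_assoc, Units.inv_mul, one_mul]
    set z' : ℍ[F,a,θ'] := ↑c * z * ↑c⁻¹ with hz'_def
    have hz'2 : z' * z' = θ • (1 : ℍ[F,a,θ']) := by
      calc z' * z' = ↑c * (z * ((↑c⁻¹ : ℍ[F,a,θ']) * ↑c * z)) * ↑c⁻¹ := by
            simp only [hz'_def, mul_assoc]
        _ = θ • (1 : ℍ[F,a,θ']) := by
            rw [Units.inv_mul, one_mul, hz, mul_smul_comm, mul_one, smul_mul_assoc, Units.mul_inv]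
    have hz'i : z' * i' = -(i' * z') := by
      calc z' * i' = ↑c * z * ((↑c⁻¹ : ℍ[F,a,θ']) * i') := by rw [hz'_def, mul_assoc]
        _ = ↑c * (z * y) * ↑c⁻¹ := by rw [hcinv]; simp only [mul_assoc]
        _ = -(↑c * y * z * ↑c⁻¹) := by rw [hzy]; simp only [mul_neg, neg_mul, mul_assoc]
        _ = -(i' * z') := by rw [← hc, hz'_def]; simp only [mul_assoc]
    obtain ⟨hre, himI⟩ := QuaternionAlgebra.re_imI_eq_zero_of_anticommute ha hz'i
    have hsq' : (z' * z').re = θ' * (z'.imJ ^ 2 - a * z'.imK ^ 2) := by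
      rw [QuaternionAlgebra.re_mul, hre, himI]
      ring
    have hθθ' : θ = θ' * (z'.imJ ^ 2 - a * z'.imK ^ 2) := by
      rw [← hsq', hz'2]
      simp
    have hN : z'.imJ ^ 2 - a * z'.imK ^ 2 ≠ 0 := by
      intro h0
      rw [h0, mul_zero] at hθθ'
      exact hθ hθθ'
    have hdiv' : θ' / θ = (z'.imJ ^ 2 - a * z'.imK ^ 2)⁻¹ := by
      rw [hθθ']
      field_simp
    rw [hdiv']
    exact (isNormFromSqrt_iff.mpr ⟨_, _, rfl⟩).inv
  · -- non-division case: both constants are norms (Cor. 2.4)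
    push Not at hdiv
    obtain ⟨h, h0, hu⟩ := hdiv
    have hθ'n : IsNormFromSqrt a θ' := by
      obtain ⟨X, Y, hXY⟩ := QuaternionAlgebra.exists_sq_sub_mul_sq_of_not_isUnit ha h0 hu
      exact isNormFromSqrt_iff.mpr ⟨X, Y, hXY.symm⟩
    have hθn : IsNormFromSqrt a θ := by
      obtain ⟨X, Y, hXY⟩ := QuaternionAlgebra.exists_sq_sub_mul_sq_of_not_isUnit ha
        (q := e.symm h) (by simpa using h0) (fun hu' ↦ hu (by simpa using hu'.map e))
      exact isNormFromSqrt_iff.mpr ⟨X, Y, hXY.symm⟩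
    exact hθ'n.div hθn

end LocalStep

end Literature.NumberTheory.Automorphic

/-! ### The class-field-theoretic input: Vignéras III §3 Cor. 3.4 in the Hilbert-symbol vocabulary
of `Literature/NumberTheory/QuadraticForms/HilbertSymbol.lean` (namespace `Literature`, parameterised by
the number field `K` and `a θ : K`, like its siblings `hilbertReciprocity K a b` (Cor. 3.3) and
`exists_hilbertSymbol_eq_neg_one_iff K` (Thm. 3.7)) -/

namespace Literature.NumberTheory.Automorphic

/-- **Hasse's norm theorem for quadratic extensions, as a local–global principle for the Hilbert
symbol** (Vignéras III §3 Cor. 3.4, *Théorème des normes dans les extensions quadratiques*: for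
`L/K` quadratic separable and `θ ∈ Kˣ`, `θ ∈ n(L)` iff `θ ∈ n(L_v)` for every place `v` — the
book even allows one exceptional place; equivalently Propriété I for `H = {L, θ}`, or Cor. 3.2
with `n = 3`). Stated for the number field `K`, `L = K(√a)` with `a ∉ K²` (every quadratic
extension of `K` is of this form) and `θ ≠ 0`, in the sufficient direction and for *all* places —
hence weaker than printed — and in the vocabulary of `HilbertSymbol.lean`: `(a, θ)_F = 1` iff
`θ ∈ n(F(√a))` (`Literature.NumberTheory.Automorphic.isNormFromSqrt_iff_hilbertSymbol_eq_one`). So: if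
`(a, θ)_v = 1` in every completion `K_v` (finite `v`) and `(a, θ)_w = 1` in every `K_w` (infinite
`w`), then `(a, θ)_K = 1`, i.e. `θ ∈ n(L)`. In the book this is deduced from Propriété I (zeta
functions); classically it is Hasse's norm theorem for cyclic extensions; neither is in Mathlib.
[cite: VignerasLNM800, Ch. III §3 Cor. 3.4] -/
def hilbertSymbol_eq_one_of_forall_completions (K : Type) [Field K] [NumberField K] (a θ : K) :
    Prop :=
  ¬ IsSquare a → θ ≠ 0 →
    (∀ v : IsDedekindDomain.HeightOneSpectrum (𝓞 K),
      QuadraticForms.hilbertSymbol (v.adicCompletion K) (algebraMap K _ a) (algebraMap K _ θ) = 1) →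
    (∀ w : NumberField.InfinitePlace K,
      QuadraticForms.hilbertSymbol w.Completion (algebraMap K _ a) (algebraMap K _ θ) = 1) →
    QuadraticForms.hilbertSymbol K a θ = 1

end Literature.NumberTheory.Automorphic

namespace Literature.NumberTheory.Automorphic

/-! ### Over a number field: the reduction of the local–global principle to the norm theorem -/

/-- **Common maximal subfields** (Vignéras III §3 Thm. 3.8, second assertion: *Deux algèbres de
quaternions ont toujours des sous-corps commutatifs maximaux communs (à isomorphisme près)*): two
quaternion algebras `D`, `D'` over a number field `K` contain a common quadratic field extension
`L = K(√a)` of `K` (`a` not a square in `K`), i.e. there are `x ∈ D`, `x' ∈ D'` with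
`x² = a = x'²`. This `Prop` is *not* an independent input: the sibling file
`QuaternionAlgebraEmbedding` proves it (`exists_common_sq_eq_of_facts`, along the printed proof:
Lemme 3.6 and the first assertion of Thm. 3.8) from the named facts
`exists_sq_eq_of_not_isSquare_ramified` (Thm. 3.8 (1)) and `ramifiedPlaces_finite`; see
`exists_common_quadratic_subfield_of_facts` below. It is named here because it is the exact
hypothesis of the assembly `nonempty_algEquiv_of_completions_of_norm_facts`. The instance
`[NumberField K]` is an explicit parameter of this `Prop` although the body does not mention it:
over an arbitrary field (e.g. `ℂ`, with `D = D' = M₂(ℂ)`) the assertion would be false.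
[cite: VignerasLNM800, Ch. III §3 Thm. 3.8] -/
def exists_common_quadratic_subfield (K : Type) [Field K] [NumberField K] (D : Type u) [Ring D]
    [Algebra K D] : Prop :=
  ∀ (D' : Type v) [Ring D'] [Algebra K D'] [IsQuaternionAlgebra K D] [IsQuaternionAlgebra K D'],
    ∃ a : K, ¬ IsSquare a ∧ (∃ x : D, x * x = algebraMap K D a) ∧
      (∃ x' : D', x' * x' = algebraMap K D' a)

section NumberField

variable (K : Type) [Field K] [NumberField K] (D : Type u) [Ring D] [Algebra K D]

/-- **Discharge of `exists_common_quadratic_subfield` relative to Thm. 3.8 (1) and the finiteness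
of ramification** (`exists_common_sq_eq_of_facts` of `QuaternionAlgebraEmbedding`): granted the
embedding criterion `exists_sq_eq_of_not_isSquare_ramified` for `D` and for every `D'`, and
`ramifiedPlaces_finite` for `D` and every `D'`, two quaternion algebras over `K` have a common
quadratic subfield. [cite: VignerasLNM800, Ch. III §3 Thm. 3.8] -/
theorem exists_common_quadratic_subfield_of_facts
    (h38 : exists_sq_eq_of_not_isSquare_ramified K D) (hfin : ramifiedPlaces_finite K D)
    (h38' : ∀ (D' : Type v) [Ring D'] [Algebra K D'], exists_sq_eq_of_not_isSquare_ramified K D')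
    (hfin' : ∀ (D' : Type v) [Ring D'] [Algebra K D'], ramifiedPlaces_finite K D') :
    exists_common_quadratic_subfield.{u, v} K D :=
  fun D' _ _ _ _ ↦ exists_common_sq_eq_of_facts K D h38 hfin D' (h38' D') (hfin' D')

variable {K D} in
/-- The local step at a field extension `F` of `K` (a completion): if `F ⊗_K D ≃ F ⊗_K D'` over
`F`, where `D ≃ {L,θ}`, `D' ≃ {L,θ'}` with `L = K(√a)`, then `θ'/θ ∈ n(F(√a))`, i.e.
`(a, θ'/θ)_F = 1` (base change `F ⊗ {L,θ} = {F ⊗ L, θ}`, Vignéras I §1 p. 3, and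
`isNormFromSqrt_div_of_algEquiv`). [folklore] -/
theorem hilbertSymbol_completion_eq_one_of_algEquiv {a θ θ' : K} (ha : a ≠ 0) (hθ : θ ≠ 0)
    (hθ' : θ' ≠ 0) (e : D ≃ₐ[K] ℍ[K,a,θ]) {D' : Type v} [Ring D'] [Algebra K D']
    (e' : D' ≃ₐ[K] ℍ[K,a,θ']) (F : Type*) [Field F] [Algebra K F]
    (g : ScalarExtension K F D ≃ₐ[F] ScalarExtension K F D') :
    QuadraticForms.hilbertSymbol F (algebraMap K F a) (algebraMap K F (θ' / θ)) = 1 := by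
  have hinj := (algebraMap K F).injective
  haveI : NeZero (2 : F) := ⟨by
    rw [← map_ofNat (algebraMap K F) 2]
    exact (map_ne_zero_iff _ hinj).mpr two_ne_zero⟩
  obtain ⟨bD⟩ := ScalarExtension.nonempty_algEquiv_quaternionAlgebra K F a θ
  obtain ⟨bD'⟩ := ScalarExtension.nonempty_algEquiv_quaternionAlgebra K F a θ'
  have E : ℍ[F,algebraMap K F a,algebraMap K F θ] ≃ₐ[F] ℍ[F,algebraMap K F a,algebraMap K F θ'] :=
    bD.symm.trans (((ScalarExtension.congrRight e.symm).trans
      (g.trans (ScalarExtension.congrRight e'))).trans bD')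
  have := QuaternionAlgebra.isNormFromSqrt_div_of_algEquiv ((map_ne_zero_iff _ hinj).mpr ha)
    ((map_ne_zero_iff _ hinj).mpr hθ) ((map_ne_zero_iff _ hinj).mpr hθ') E
  rw [← map_div₀] at this
  exact (isNormFromSqrt_iff_hilbertSymbol_eq_one ((map_ne_zero_iff _ hinj).mpr ha)
    ((map_ne_zero_iff _ hinj).mpr (div_ne_zero hθ' hθ))).mp this

/-- **Vignéras III §3 Thm. 3.1, uniqueness / injectivity of `Quat(K) → ⊕_v Quat(K_v)`, reduced to
its printed inputs Cor. 3.4 and Thm. 3.8.** If two quaternion algebras `D`, `D'` over a number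
field become isomorphic over every completion `K_v` (finite `v`) and `K_w` (infinite `w`), then
`D ≃ₐ[K] D'` — *assuming* the named facts `exists_common_quadratic_subfield K D` (Thm. 3.8) and
`Literature.hilbertSymbol_eq_one_of_forall_completions K a θ` for all `a θ : K` (Cor. 3.4). Honest proof following the book (proof
of Thm. 3.8): a common quadratic subfield `L = K(√a)` gives `D ≃ {L,θ}`, `D' ≃ {L,θ'}` (Cor. 2.2,
`exists_algEquiv_quaternionAlgebra_of_sq_eq`); locally `{L_v,θ} ≃ {L_v,θ'}` forces
`θ'/θ ∈ n(L_v)`, i.e. `(a, θ'/θ)_v = 1` (`hilbertSymbol_completion_eq_one_of_algEquiv`); the norm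
theorem gives `(a, θ'/θ)_K = 1`, i.e. `θ'/θ = n(m) ∈ n(L)`; and `{L, θ n(m)} ≃ {L, θ}`
(`nonempty_algEquiv_rescale`). The conclusion is the statement of the local–global principle for
isomorphism, vendored as the named fact `nonempty_algEquiv_of_completions K D` in the
(forthcoming) sibling `QuaternionAlgebraClassification`, which derives the uniqueness theorem from
it. [cite: VignerasLNM800, Ch. III §3 Thm. 3.1, Cor. 3.4, Thm. 3.8] -/
theorem nonempty_algEquiv_of_completions_of_norm_facts
    (hC : exists_common_quadratic_subfield.{u, v} K D)
    (hN : ∀ a θ : K, hilbertSymbol_eq_one_of_forall_completions K a θ)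
    (D' : Type v) [Ring D'] [Algebra K D'] [IsQuaternionAlgebra K D] [IsQuaternionAlgebra K D']
    (hf : ∀ v : HeightOneSpectrum (𝓞 K),
      Nonempty (ScalarExtension K (v.adicCompletion K) D ≃ₐ[v.adicCompletion K]
        ScalarExtension K (v.adicCompletion K) D'))
    (hi : ∀ w : InfinitePlace K,
      Nonempty (ScalarExtension K w.Completion D ≃ₐ[w.Completion]
        ScalarExtension K w.Completion D')) :
    Nonempty (D ≃ₐ[K] D') := by
  obtain ⟨a, ha, ⟨x, hx⟩, ⟨x', hx'⟩⟩ := hC D'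
  obtain ⟨θ, hθ, ⟨e⟩⟩ := IsQuaternionAlgebra.exists_algEquiv_quaternionAlgebra_of_sq_eq K ha hx
  obtain ⟨θ', hθ', ⟨e'⟩⟩ := IsQuaternionAlgebra.exists_algEquiv_quaternionAlgebra_of_sq_eq K ha hx'
  have ha0 : a ≠ 0 := fun h ↦ ha ⟨0, by rw [h, mul_zero]⟩
  have hq0 : θ' / θ ≠ 0 := div_ne_zero hθ' hθ
  have hglob : IsNormFromSqrt a (θ' / θ) :=
    (isNormFromSqrt_iff_hilbertSymbol_eq_one ha0 hq0).mpr
      (hN a (θ' / θ) ha hq0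
        (fun v ↦ hilbertSymbol_completion_eq_one_of_algEquiv ha0 hθ hθ' e e' _ (hf v).some)
        (fun w ↦ hilbertSymbol_completion_eq_one_of_algEquiv ha0 hθ hθ' e e' _ (hi w).some))
  obtain ⟨p, q, hpq⟩ := isNormFromSqrt_iff.mp hglob
  have hN0 : p ^ 2 - a * q ^ 2 ≠ 0 := by rw [← hpq]; exact div_ne_zero hθ' hθ
  have hθ'eq : θ' = θ * (p ^ 2 - a * q ^ 2) := by rw [← hpq, mul_div_cancel₀ θ' hθ]
  obtain ⟨r⟩ := QuaternionAlgebra.nonempty_algEquiv_rescale (b := θ) p q hN0 hθ'eq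
  exact ⟨e.trans (r.symm.trans e'.symm)⟩

end NumberField

end Literature.NumberTheory.Automorphic
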